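import Mathlib.Algebra.Homology.DerivedCategory.Ext.ExactSequences
import HarnessLib

/-!
# Iterated connecting classes of an exact augmented cochain complex

Let `C` be an abelian category, `K : CochainComplex C ℕ` and `ε : M → K⁰` an augmentation making
`0 → M → K⁰ → K¹ → K² → ⋯` EXACT (`ExactAugmentation K M`: `ε` mono, `M → K⁰ → K¹` exact, and `K`
exact in every positive degree) — e.g. the Čech resolution of a sheaf. Splitting the resolution into
the short exact sequences

  `T_n : 0 → Zⁿ → Kⁿ → Zⁿ⁺¹ → 0`  (`Zⁿ = ker dⁿ`, Mathlib's `K.cycles n`; `Z⁰ ≅ M` via `ε`),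

we define the **iterated connecting class** `κ_n ∈ Extⁿ(Zⁿ, M)` (`kappa`: `κ₀ = [Z⁰ ≅ M]`,
`κ_{n+1} = [T_n] ∘ κ_n`, the Yoneda composite of the classes of `T_n, …, T₀`) and, for a
"cocycle" `ω : A → Kⁿ` (`ω ≫ d = 0`), the class

  `θ(ω) = [ω̄] ∘ κ_n ∈ Extⁿ(A, M)`  (`theta`; `ω̄ : A → Zⁿ` the factorisation),

the abstract form of "a Čech cocycle defines a cohomology / `Ext` class" (Godement,
*Théorie des faisceaux*, II.5.9; Hartshorne III.4). Proved here: `θ` is additive and kills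
coboundaries `ω = β ≫ d` (`theta_eq_zero_of_boundary`); NATURALITY for morphisms of augmented
complexes (`theta_comp_map`: `θ'(ω ≫ φ) = θ(ω) ∘ [μ]`) and for degree-`1` maps of complexes
`ψ_n : Kⁿ → K'ⁿ⁺¹` commuting with the differentials (`theta_comp_degOne`:
`θ'(ω ≫ ψ) = θ(ω) ∘ θ'(ε ≫ ψ₀)`, the abstract cup product with a `1`-cocycle). Everything is on
Mathlib's `Ext` (`extClass`, `Ext.comp`, `extClass_naturality`); no named facts.

## References

* R. Godement, *Topologie algébrique et théorie des faisceaux*, Hermann (1958), II.5.9–5.10.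
* R. Hartshorne, *Algebraic Geometry*, GTM 52 (1977), III.1 (δ-functors), III.4 (Lemma 4.4,
  Thm. 4.5: Čech cocycles and derived-functor cohomology). [Hartshorne1977]
-/

universe w v u

open CategoryTheory CategoryTheory.Limits CategoryTheory.Abelian HomologicalComplex

namespace Literature.Algebra.Homology

set_option backward.isDefEq.respectTransparency false
set_option backward.defeqAttrib.useBackward true

variable {C : Type u} [Category.{v} C] [Abelian C]

/-- An **exact augmentation** of a cochain complex `K` indexed by `ℕ`: a monomorphism
`ε : M → K⁰` with `M → K⁰ → K¹` exact and `K` exact in all positive degrees, i.e. `K` is a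
resolution of `M` (e.g. the Čech resolution of a sheaf of modules). [folklore] -/
structure ExactAugmentation (K : CochainComplex C ℕ) (M : C) where
  /-- the augmentation `ε : M → K⁰` -/
  ε : M ⟶ K.X 0
  ε_d : ε ≫ K.d 0 1 = 0
  mono_ε : Mono ε
  exact₀ : (ShortComplex.mk ε (K.d 0 1) ε_d).Exact
  exactAt_succ : ∀ n : ℕ, K.ExactAt (n + 1)

namespace ExactAugmentation

variable {K : CochainComplex C ℕ} {M : C}

/-! ### The short exact pieces `T_n` of the resolution and `Z⁰ ≅ M` -/

/-- `Kⁿ → Zⁿ⁺¹` (the corestriction of `dⁿ`) is an epimorphism, by exactness at `n + 1`.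
[folklore] -/
lemma epi_toCycles (a : ExactAugmentation K M) (n : ℕ) : Epi (K.toCycles n (n + 1)) := by
  have h := (K.exactAt_iff' n (n + 1) (n + 2) (CochainComplex.prev_nat_succ n)
    (CochainComplex.next ℕ (n + 1))).mp (a.exactAt_succ n)
  have h1 : Epi (K.sc' n (n + 1) (n + 2)).toCycles := h.epi_toCycles
  have h2 : K.toCycles n (n + 1) = (K.sc' n (n + 1) (n + 2)).toCycles ≫
      (K.cyclesIsoSc' n (n + 1) (n + 2) (CochainComplex.prev_nat_succ n)
        (CochainComplex.next ℕ (n + 1))).inv := by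
    rw [← K.toCycles_cyclesIsoSc'_hom n (n + 1) (n + 2) (CochainComplex.prev_nat_succ n)
      (CochainComplex.next ℕ (n + 1)), Category.assoc, Iso.hom_inv_id, Category.comp_id]
  rw [h2]
  exact epi_comp _ _

/-- The pieces `T_n : Zⁿ → Kⁿ → Zⁿ⁺¹` (reducible, so that `(T K n).X₁ = K.cycles n` etc. hold by
`rfl` at reducible transparency). [folklore] -/
noncomputable abbrev T (K : CochainComplex C ℕ) (n : ℕ) : ShortComplex C :=
  ShortComplex.mk (K.iCycles n) (K.toCycles n (n + 1))
    (by rw [← cancel_mono (K.iCycles (n + 1)), Category.assoc, toCycles_i, zero_comp, iCycles_d])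

/-- `T_n` is short exact. [folklore] -/
lemma shortExact_T (a : ExactAugmentation K M) (n : ℕ) : (T K n).ShortExact := by
  haveI : Epi (T K n).g := a.epi_toCycles n
  haveI : Mono (T K n).f := inferInstanceAs (Mono (K.iCycles n))
  refine { exact := ?_ }
  let φ : T K n ⟶ ShortComplex.mk (K.iCycles n) (K.d n (n + 1)) (K.iCycles_d n (n + 1)) :=
    { τ₁ := 𝟙 _, τ₂ := 𝟙 _, τ₃ := K.iCycles (n + 1),
      comm₁₂ := by simp, comm₂₃ := by simp }
  exact (ShortComplex.exact_iff_of_epi_of_isIso_of_mono φ).mpr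
    (ShortComplex.exact_of_f_is_kernel _ (K.cyclesIsKernel n (n + 1) (CochainComplex.next ℕ n)))

/-- The isomorphism `M ≅ Z⁰` induced by the augmentation (`M` is the kernel of `d⁰`).
[folklore] -/
noncomputable def isoCyclesZero (a : ExactAugmentation K M) : M ≅ K.cycles 0 :=
  haveI := a.mono_ε
  IsLimit.conePointUniqueUpToIso a.exact₀.fIsKernel (K.cyclesIsKernel 0 1 (CochainComplex.next ℕ 0))

/-- `(M ≅ Z⁰) ≫ (Z⁰ ↪ K⁰) = ε`. [folklore] -/
@[reassoc (attr := simp)]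
lemma isoCyclesZero_hom_iCycles (a : ExactAugmentation K M) :
    a.isoCyclesZero.hom ≫ K.iCycles 0 = a.ε :=
  haveI := a.mono_ε
  IsLimit.conePointUniqueUpToIso_hom_comp a.exact₀.fIsKernel
    (K.cyclesIsKernel 0 1 (CochainComplex.next ℕ 0)) WalkingParallelPair.zero

/-- `(Z⁰ ≅ M) ≫ ε = (Z⁰ ↪ K⁰)`. [folklore] -/
@[reassoc (attr := simp)]
lemma isoCyclesZero_inv_ε (a : ExactAugmentation K M) :
    a.isoCyclesZero.inv ≫ a.ε = K.iCycles 0 := by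
  rw [← isoCyclesZero_hom_iCycles, Iso.inv_hom_id_assoc]

/-! ### Iterated connecting classes and the class of a cocycle -/

/-- **The iterated connecting class** `κ_n ∈ Extⁿ(Zⁿ, M)`: `κ₀ = [Z⁰ ≅ M]`,
`κ_{n+1} = [T_n] ∘ κ_n`. [folklore] -/
noncomputable def kappa [HasExt.{w} C] (a : ExactAugmentation K M) :
    ∀ n : ℕ, Ext.{w} (K.cycles n) M n
  | 0 => Ext.mk₀ a.isoCyclesZero.inv
  | n + 1 => (a.shortExact_T n).extClass.comp (kappa a n) (by omega)

variable [HasExt.{w} C] (a : ExactAugmentation K M)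

/-- `κ₀ = [Z⁰ ≅ M]`. [folklore] -/
lemma kappa_zero : a.kappa 0 = Ext.mk₀ a.isoCyclesZero.inv := rfl

/-- `κ_{n+1} = [T_n] ∘ κ_n`. [folklore] -/
lemma kappa_succ (n : ℕ) :
    a.kappa (n + 1) = (a.shortExact_T n).extClass.comp (a.kappa n) (by omega) := rfl

/-- The factorisation `ω̄ : A → Zⁿ` of a cocycle `ω : A → Kⁿ`. [folklore] -/
noncomputable abbrev bar {A : C} {n : ℕ} (ω : A ⟶ K.X n) (hω : ω ≫ K.d n (n + 1) = 0) :
    A ⟶ K.cycles n :=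
  K.liftCycles ω (n + 1) (CochainComplex.next ℕ _) hω

/-- **The class of a cocycle**: `θ(ω) = [ω̄] ∘ κ_n ∈ Extⁿ(A, M)` for `ω : A → Kⁿ` with
`ω ≫ d = 0`. [folklore] -/
noncomputable def theta {A : C} {n : ℕ} (ω : A ⟶ K.X n) (hω : ω ≫ K.d n (n + 1) = 0) :
    Ext.{w} A M n :=
  (Ext.mk₀ (bar ω hω)).comp (a.kappa n) (zero_add _)

/-- Unfolding `θ`. [folklore] -/
lemma theta_def {A : C} {n : ℕ} (ω : A ⟶ K.X n) (hω : ω ≫ K.d n (n + 1) = 0) :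
    a.theta ω hω = (Ext.mk₀ (bar ω hω)).comp (a.kappa n) (zero_add _) := rfl

/-- `θ` does not depend on the proof of `ω ≫ d = 0`, and equal cocycles have equal classes.
[folklore] -/
lemma theta_congr {A : C} {n : ℕ} {ω ω' : A ⟶ K.X n} (h : ω = ω') (hω : ω ≫ K.d n (n + 1) = 0)
    (hω' : ω' ≫ K.d n (n + 1) = 0) : a.theta ω hω = a.theta ω' hω' := by
  subst h; rfl

/-- `θ` is additive. [folklore] -/
lemma theta_add {A : C} {n : ℕ} (ω ω' : A ⟶ K.X n) (hω : ω ≫ K.d n (n + 1) = 0)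
    (hω' : ω' ≫ K.d n (n + 1) = 0) :
    a.theta (ω + ω') (by rw [Preadditive.add_comp, hω, hω', add_zero]) =
      a.theta ω hω + a.theta ω' hω' := by
  simp only [theta_def]
  rw [← Ext.add_comp, ← Ext.mk₀_add]
  congr 2
  rw [← cancel_mono (K.iCycles n)]
  simp [bar, Preadditive.add_comp]

/-- `θ(0) = 0`. [folklore] -/
lemma theta_zero {A : C} {n : ℕ} (h : (0 : A ⟶ K.X n) ≫ K.d n (n + 1) = 0) :
    a.theta (0 : A ⟶ K.X n) h = 0 := by
  rw [theta_def]
  have : bar (0 : A ⟶ K.X n) h = 0 := by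
    rw [← cancel_mono (K.iCycles n)]; simp [bar]
  rw [this, Ext.mk₀_zero, Ext.zero_comp]

/-- `θ(g ≫ ω) = [g] ∘ θ(ω)`. [folklore] -/
lemma theta_comp_left {A B : C} {n : ℕ} (g : B ⟶ A) (ω : A ⟶ K.X n)
    (hω : ω ≫ K.d n (n + 1) = 0) :
    a.theta (g ≫ ω) (by rw [Category.assoc, hω, comp_zero]) =
      (Ext.mk₀ g).comp (a.theta ω hω) (zero_add _) := by
  have hbar : bar (g ≫ ω) (by rw [Category.assoc, hω, comp_zero]) = g ≫ bar ω hω := by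
    rw [← cancel_mono (K.iCycles n)]
    simp [bar]
  rw [theta_def, theta_def, hbar, Ext.mk₀_comp_mk₀_assoc]

/-- `[Kⁿ → Zⁿ⁺¹] ∘ κ_{n+1} = 0` (a boundary followed by the connecting class vanishes).
[folklore] -/
lemma mk₀_toCycles_comp_kappa (n : ℕ) :
    (Ext.mk₀ (K.toCycles n (n + 1))).comp (a.kappa (n + 1)) (zero_add _) = 0 := by
  rw [kappa_succ, ← Ext.comp_assoc (Ext.mk₀ (K.toCycles n (n + 1))) (a.shortExact_T n).extClass
    (a.kappa n) (zero_add 1) (by omega) (by omega)]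
  have h0 : (Ext.mk₀ (K.toCycles n (n + 1))).comp (a.shortExact_T n).extClass (zero_add 1) = 0 :=
    (a.shortExact_T n).comp_extClass
  rw [h0, Ext.zero_comp]

/-- **`θ` kills coboundaries**: `θ(β ≫ d) = 0`. [folklore] -/
theorem theta_eq_zero_of_boundary {A : C} {n : ℕ} (β : A ⟶ K.X n) (ω : A ⟶ K.X (n + 1))
    (hω : ω ≫ K.d (n + 1) (n + 1 + 1) = 0) (h : ω = β ≫ K.d n (n + 1)) : a.theta ω hω = 0 := by
  have hbar : bar ω hω = β ≫ K.toCycles n (n + 1) := by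
    rw [← cancel_mono (K.iCycles (n + 1))]
    simp [bar, h]
  rw [theta_def, hbar, ← Ext.mk₀_comp_mk₀_assoc, mk₀_toCycles_comp_kappa, Ext.comp_zero]

/-! ### Naturality for morphisms of augmented complexes -/

section Naturality

variable {K' : CochainComplex C ℕ} {M' : C} (a' : ExactAugmentation K' M') (φ : K ⟶ K')
  (μ : M ⟶ M') (hμ : a.ε ≫ φ.f 0 = μ ≫ a'.ε)

omit [HasExt C] in
/-- `toCycles` is natural. [folklore] -/
lemma toCycles_comp_cyclesMap (n : ℕ) :
    K.toCycles n (n + 1) ≫ cyclesMap φ (n + 1) = φ.f n ≫ K'.toCycles n (n + 1) := by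
  rw [← cancel_mono (K'.iCycles (n + 1))]
  simp only [Category.assoc, cyclesMap_i, toCycles_i_assoc, toCycles_i, HomologicalComplex.Hom.comm]

include hμ in
omit [HasExt C] in
/-- The isomorphisms `M ≅ Z⁰` are natural. [folklore] -/
lemma isoCyclesZero_hom_comp_cyclesMap :
    a.isoCyclesZero.hom ≫ cyclesMap φ 0 = μ ≫ a'.isoCyclesZero.hom := by
  rw [← cancel_mono (K'.iCycles 0)]
  simp only [Category.assoc, cyclesMap_i, isoCyclesZero_hom_iCycles_assoc, isoCyclesZero_hom_iCycles]
  exact hμ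

include hμ in
/-- Naturality of the iterated connecting classes: `[Z(φ)] ∘ κ'_n = κ_n ∘ [μ]`. [folklore] -/
lemma mk₀_cyclesMap_comp_kappa (n : ℕ) :
    (Ext.mk₀ (cyclesMap φ n)).comp (a'.kappa n) (zero_add _) =
      (a.kappa n).comp (Ext.mk₀ μ) (add_zero _) := by
  induction n with
  | zero =>
    rw [kappa_zero, kappa_zero, Ext.mk₀_comp_mk₀, Ext.mk₀_comp_mk₀]
    congr 1
    rw [← cancel_epi a.isoCyclesZero.hom, ← cancel_mono a'.isoCyclesZero.hom]
    simp only [Category.assoc, Iso.inv_hom_id, Category.comp_id, Iso.hom_inv_id_assoc]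
    exact isoCyclesZero_hom_comp_cyclesMap a a' φ μ hμ
  | succ n ih =>
    let f : T K n ⟶ T K' n :=
      { τ₁ := cyclesMap φ n, τ₂ := φ.f n, τ₃ := cyclesMap φ (n + 1),
        comm₁₂ := by simp,
        comm₂₃ := by simpa using (toCycles_comp_cyclesMap φ n).symm }
    have hnat := ShortComplex.ShortExact.extClass_naturality (a.shortExact_T n)
      (a'.shortExact_T n) f
    have hnat' : (Ext.mk₀ (cyclesMap φ (n + 1))).comp (a'.shortExact_T n).extClass (zero_add 1) =
        (a.shortExact_T n).extClass.comp (Ext.mk₀ (cyclesMap φ n)) (add_zero 1) := hnat.symm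
    rw [kappa_succ, kappa_succ, ← Ext.comp_assoc (Ext.mk₀ (cyclesMap φ (n + 1)))
      (a'.shortExact_T n).extClass (a'.kappa n) (zero_add 1) (by omega) (by omega), hnat',
      Ext.comp_assoc _ _ _ (add_zero 1) (zero_add n) (by omega), ih,
      ← Ext.comp_assoc _ _ _ (show 1 + n = n + 1 by omega) (add_zero n) (by omega)]

include hμ in
/-- **Naturality of `θ`**: `θ'(ω ≫ φⁿ) = θ(ω) ∘ [μ]` for a morphism of augmented complexes
`(φ, μ)`. [folklore] -/
theorem theta_comp_map {A : C} {n : ℕ} (ω : A ⟶ K.X n) (hω : ω ≫ K.d n (n + 1) = 0)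
    (hω' : (ω ≫ φ.f n) ≫ K'.d n (n + 1) = 0) :
    a'.theta (ω ≫ φ.f n) hω' = (a.theta ω hω).comp (Ext.mk₀ μ) (add_zero _) := by
  have hbar : bar (ω ≫ φ.f n) hω' = bar ω hω ≫ cyclesMap φ n := by
    rw [← cancel_mono (K'.iCycles n)]
    simp [bar]
  rw [theta_def, theta_def, hbar, ← Ext.mk₀_comp_mk₀_assoc, mk₀_cyclesMap_comp_kappa a a' φ μ hμ,
    Ext.comp_assoc_of_third_deg_zero]

omit [HasExt C] in
/-- The cocycle condition is preserved by chain maps. [folklore] -/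
lemma comp_f_d_eq_zero {A : C} {n : ℕ} (ω : A ⟶ K.X n) (hω : ω ≫ K.d n (n + 1) = 0) :
    (ω ≫ φ.f n) ≫ K'.d n (n + 1) = 0 := by
  rw [Category.assoc, φ.comm, reassoc_of% hω, zero_comp]

end Naturality

/-! ### Degree-one maps of complexes (cup product with a `1`-cocycle) -/

section DegOne

variable {K' : CochainComplex C ℕ} {M' : C} (a' : ExactAugmentation K' M')
  (ψ : ∀ n : ℕ, K.X n ⟶ K'.X (n + 1))
  (hψ : ∀ n : ℕ, K.d n (n + 1) ≫ ψ (n + 1) = ψ n ≫ K'.d (n + 1) (n + 1 + 1))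

include hψ in
omit [HasExt C] in
/-- `(Zⁿ ↪ Kⁿ) ≫ ψ_n` is a cocycle. [folklore] -/
lemma iCycles_ψ_d (n : ℕ) : (K.iCycles n ≫ ψ n) ≫ K'.d (n + 1) (n + 1 + 1) = 0 := by
  rw [Category.assoc, ← hψ, iCycles_d_assoc, zero_comp]

/-- The map `Zⁿ → Z'ⁿ⁺¹` induced on cycles by a degree-one map of complexes. [folklore] -/
noncomputable def cyclesDegOne (n : ℕ) : K.cycles n ⟶ K'.cycles (n + 1) :=
  K'.liftCycles (K.iCycles n ≫ ψ n) (n + 1 + 1) (CochainComplex.next ℕ _) (iCycles_ψ_d ψ hψ n)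

omit [HasExt C] in
/-- `Z(ψ)_n ≫ (Z'ⁿ⁺¹ ↪ K'ⁿ⁺¹) = (Zⁿ ↪ Kⁿ) ≫ ψ_n`. [folklore] -/
@[reassoc (attr := simp)]
lemma cyclesDegOne_i (n : ℕ) :
    cyclesDegOne ψ hψ n ≫ K'.iCycles (n + 1) = K.iCycles n ≫ ψ n := by
  simp [cyclesDegOne]

omit [HasExt C] in
/-- `Z(ψ)` intertwines the corestricted differentials. [folklore] -/
lemma toCycles_comp_cyclesDegOne (n : ℕ) :
    K.toCycles n (n + 1) ≫ cyclesDegOne ψ hψ (n + 1) = ψ n ≫ K'.toCycles (n + 1) (n + 1 + 1) := by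
  rw [← cancel_mono (K'.iCycles (n + 1 + 1))]
  simp [hψ]

include hψ in
omit [HasExt C] in
/-- The `1`-cocycle `ε ≫ ψ₀` attached to a degree-one map. [folklore] -/
lemma ε_ψ_d : (a.ε ≫ ψ 0) ≫ K'.d (0 + 1) (0 + 1 + 1) = 0 := by
  rw [Category.assoc, ← hψ, reassoc_of% a.ε_d, zero_comp]

omit [HasExt C] in
/-- In degree `0`, `Z(ψ)` is the factorisation of the `1`-cocycle `ε ≫ ψ₀`. [folklore] -/
lemma isoCyclesZero_inv_comp_bar :
    a.isoCyclesZero.inv ≫ bar (a.ε ≫ ψ 0) (ε_ψ_d a ψ hψ) = cyclesDegOne ψ hψ 0 := by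
  rw [← cancel_mono (K'.iCycles (0 + 1))]
  simp [bar]

/-- Compatibility of the iterated connecting classes with a degree-one map:
`[Z(ψ)] ∘ κ'_{n+1} = κ_n ∘ θ'(ε ≫ ψ₀)`. [folklore] -/
lemma mk₀_cyclesDegOne_comp_kappa (n : ℕ) :
    (Ext.mk₀ (cyclesDegOne ψ hψ n)).comp (a'.kappa (n + 1)) (zero_add _) =
      (a.kappa n).comp (a'.theta (a.ε ≫ ψ 0) (ε_ψ_d a ψ hψ)) rfl := by
  induction n with
  | zero =>
    rw [kappa_zero, theta_def, Ext.mk₀_comp_mk₀_assoc, isoCyclesZero_inv_comp_bar]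
  | succ n ih =>
    let f : T K n ⟶ T K' (n + 1) :=
      { τ₁ := cyclesDegOne ψ hψ n, τ₂ := ψ n, τ₃ := cyclesDegOne ψ hψ (n + 1),
        comm₁₂ := by simp,
        comm₂₃ := by simpa using (toCycles_comp_cyclesDegOne ψ hψ n).symm }
    have hnat := ShortComplex.ShortExact.extClass_naturality (a.shortExact_T n)
      (a'.shortExact_T (n + 1)) f
    have hnat' : (Ext.mk₀ (cyclesDegOne ψ hψ (n + 1))).comp (a'.shortExact_T (n + 1)).extClass
        (zero_add 1) = (a.shortExact_T n).extClass.comp (Ext.mk₀ (cyclesDegOne ψ hψ n))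
          (add_zero 1) := hnat.symm
    rw [kappa_succ a' (n + 1), ← Ext.comp_assoc (Ext.mk₀ (cyclesDegOne ψ hψ (n + 1)))
      (a'.shortExact_T (n + 1)).extClass (a'.kappa (n + 1)) (zero_add 1) (by omega) (by omega),
      hnat', Ext.comp_assoc _ _ _ (add_zero 1) (zero_add (n + 1)) (by omega), ih, kappa_succ,
      Ext.comp_assoc _ _ _ (by omega) rfl (by omega)]

/-- **`θ` and degree-one maps** (abstract cup product with the `1`-cocycle `ε ≫ ψ₀`):
`θ'(ω ≫ ψ_n) = θ(ω) ∘ θ'(ε ≫ ψ₀)`. [folklore] -/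
theorem theta_comp_degOne {A : C} {n : ℕ} (ω : A ⟶ K.X n) (hω : ω ≫ K.d n (n + 1) = 0)
    (hω' : (ω ≫ ψ n) ≫ K'.d (n + 1) (n + 1 + 1) = 0) :
    a'.theta (ω ≫ ψ n) hω' = (a.theta ω hω).comp (a'.theta (a.ε ≫ ψ 0) (ε_ψ_d a ψ hψ)) rfl := by
  have hbar : bar (ω ≫ ψ n) hω' = bar ω hω ≫ cyclesDegOne ψ hψ n := by
    rw [← cancel_mono (K'.iCycles (n + 1))]
    simp [bar]
  rw [theta_def, theta_def a, hbar, ← Ext.mk₀_comp_mk₀_assoc, mk₀_cyclesDegOne_comp_kappa a a' ψ hψ]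
  exact (Ext.comp_assoc _ _ _ (zero_add _) rfl (by omega)).symm

include hψ in
omit [HasExt C] in
/-- The cocycle condition is preserved by degree-one maps of complexes. [folklore] -/
lemma comp_ψ_d_eq_zero {A : C} {n : ℕ} (ω : A ⟶ K.X n) (hω : ω ≫ K.d n (n + 1) = 0) :
    (ω ≫ ψ n) ≫ K'.d (n + 1) (n + 1 + 1) = 0 := by
  rw [Category.assoc, ← hψ, reassoc_of% hω, zero_comp]

end DegOne

end ExactAugmentation

end Literature.Algebra.Homology
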